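import Literature.NumberTheory.Automorphic.UnitaryGroupSingularHeisenbergFibre
import Literature.NumberTheory.Automorphic.UnitaryGroupSingularCentreFamily
import Literature.NumberTheory.Automorphic.TraceZeroCentreLineLatticeSum
import Literature.NumberTheory.Automorphic.UnitaryGroupCuspIntegralSiegelMajorant
import HarnessLib

/-!
# The torus majorant of Rogawski's singular bracket: `‖b_T(t · u(x,y) · k)‖ ≤ 1_{C_X}(x) · 1_{H₀ ≤ H(t)} · (A + B · H(t)^{1−1/[E:ℚ]})`
# on the torus Siegel set, uniformly in `k ∈ K_U` and `y`
(Rogawski, *Automorphic Representations of Unitary Groups in Three Variables* (1990), §7.2 Prop. 7.2.1, p. 95: «the integrand …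
is absolutely integrable for every `T`»; Arthur, *A trace formula for reductive groups I*, Duke Math. J. 45 (1978), §8)

Topic `NumberTheory/Automorphic`; namespace `Literature.NumberTheory.Automorphic.UnitaryGroup`. THEOREMS ONLY over accepted tree
modules (no definition, no named fact, no instance, no notation, no `sorry`). Brick (F6b-2) of the row (L5-iii-b2) (b2-β)
«`|b_T| ∈ L¹(Z B_γ(F)∖G(𝔸))` for every `T > 0`» of the T1-qs LAW 5 road of `Cruxes/H413/Lines/F0_T1InnerFormTraceIdentity.lean`
(cell `pub/hodgecm-mathlib`, crux H413). The bracket `b_T` is A-p19's ★ `UnitaryGroupSingularBracket` expression (spelled inline,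
covolume-normalised `T`-piece); along `t · u(x, y) · k` it reads (★ A-p14 `tsum_singular_torus_heisElt_mul`,
`integral_center_singular_torus_heisElt_mul`, `borelHeight_torus_heisElt_mul`)

  `b_T(t u(x,y) k) = Σ_{w ∈ E⁻∖0} F_{k,x}(a_t w) − 1_{T < ‖d₀‖ H(k)} · (μY 𝓕⁻)⁻¹ χ⁻(a_t)⁻¹ ∫ F_{k,x} dμY`,

`F_{k,x}(y) = f(k⁻¹ u(x)⁻¹ (γ₀ n(y)) u(x) k)` the centre family of ★ (F6b-1) `UnitaryGroupSingularCentreFamily`, `a_t = d₀⁻¹d₂`. THE THREE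
REGIMES of ★ (F6a-2) `TraceZeroCentreLineLatticeSum` in the height `H(t) = ‖d₀‖ H(1)`: LOW `H < H₀` (T-piece off, lattice escapes:
`b_T = 0`), MIDDLE `H₀ ≤ H ≤ R` (finitely many terms: bounded), CUSP `H > R = max(T,1)` (Weil's Riemann-sum estimate with the oscillation
`C_f H^{−1/[E:ℚ]}` of ★ (F6b-1)∕(F5) and the module `χ⁻(a_t)⁻¹ = ‖d₀‖`: `≤ M + B H^{1−1/[E:ℚ]}`), glued into ONE MAJORANT
(**`exists_majorant_norm_singularBracket_torus_heisElt_mul`**): compact `C_X ⊆ 𝔸_E`, `H₀ > 0`, `A, B ≥ 0` with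

  `‖b_T(t · u(x,y) · k)‖ ≤ 1_{C_X}(x) · (if H(t) < H₀ then 0 else A + B · H(t)^{1−1/[E:ℚ]})`

for all `t` in the torus Siegel set, `k ∈ K_U`, `x ∈ 𝔸_E`, `y ∈ 𝔸_E⁻`. The torus inputs — the compact window range of `a_t⁻¹` and the
norm∕module dictionary `χ⁻(a_t) = ‖d₀‖⁻¹`, `‖a_t‖ = ‖d₀‖⁻²` — enter as HYPOTHESES (`hwin`, `hmod`, `hnorm`) in the letters of
B-p14's (F7) `UnitaryGroupTorusSiegelHeightWindow`; the integration over `Z B_γ(F)∖G(𝔸)` is (F6b-3).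

## References
* J. D. Rogawski, *Automorphic Representations of Unitary Groups in Three Variables*, Ann. of Math. Stud. 123 (1990), §7.2
  Prop. 7.2.1 (pp. 93–95) [Rogawski1990].
* J. Arthur, *A trace formula for reductive groups I*, Duke Math. J. 45 (1978), §8 [Arthur1978TraceFormulaI].
-/

set_option autoImplicit false

noncomputable section

open MeasureTheory Measure NumberField IsDedekindDomain Set Topology
open scoped NNReal ENNReal Pointwise

namespace Literature.NumberTheory.Automorphic

namespace UnitaryGroup

variable {F E : Type} [Field F] [NumberField F] [Field E] [NumberField E] [Algebra F E]
  {c : E ≃ₐ[F] E}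

section Majorant

omit [NumberField F] in
/-- The principal idele of a non-zero natural number is `c`-fixed. [folklore] -/
private theorem conjAdele_natCast_units {m : ℕ} (hm : (m : E) ≠ 0) :
    conjAdele F E c ((Units.map (algebraMap E (AdeleRing (𝓞 E) E) : E →* AdeleRing (𝓞 E) E) (Units.mk0 (m : E) hm) :
      (AdeleRing (𝓞 E) E)ˣ) : AdeleRing (𝓞 E) E) =
      (Units.map (algebraMap E (AdeleRing (𝓞 E) E) : E →* AdeleRing (𝓞 E) E) (Units.mk0 (m : E) hm) : _) := by
  rw [Units.coe_map, MonoidHom.coe_coe, Units.val_mk0, ← algebraMap_conj, RingHom.coe_coe, map_natCast]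

omit [NumberField F] in
/-- `m • v = ι(m) • v` on `𝔸_E⁻`. [folklore] -/
private theorem nsmul_eq_smulTraceZero {m : ℕ} (hm : (m : E) ≠ 0) (v : traceZeroAdele F E c) :
    m • v = smulTraceZero _ (conjAdele_natCast_units (F := F) (c := c) hm) v := by
  refine Subtype.ext ?_
  rw [AddSubgroupClass.coe_nsmul, coe_smulTraceZero, Units.coe_map, MonoidHom.coe_coe, Units.val_mk0, map_natCast, nsmul_eq_mul]

variable [LocallyCompactSpace (AdeleRing (𝓞 E) E)] [MeasurableSpace (AdeleRing (𝓞 E) E)] [BorelSpace (AdeleRing (𝓞 E) E)]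

/-- **THE TORUS MAJORANT OF THE SINGULAR BRACKET.** Let `f ∈ C_c^∞(U(J₃)(𝔸_F))`, `γ₀ = d(a, b, a)` the singular base point, `S_T` a set
of torus elements with the clauses `hroot` (root compactum above height `1`), `hbal` (BALANCE) and `hH` (`H(t) = ‖d₀ t‖ · H(1)`) of ★
`exists_torusSiegelSet`, the height-window range `hwin` and the dictionary `hH`, `hmod`, `hnorm` of B-p14's (F7) `UnitaryGroupTorusSiegelHeightWindow` (`exists_isCompact_centralCharacter_inv_mem`, `borelHeight_torus_coe_eq`, `traceZeroModulus_centralCharacter_torus`, `ideleNorm_centralCharacter_torus`), `μY` a Haar measure of `𝔸_E⁻` and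
`T > 0`. Then there are a compact `C_X ⊆ 𝔸_E`, `H₀ > 0` and `A, B ≥ 0` such that for every `t ∈ S_T`, every `k ∈ K_U`, every `x, y`:
`‖b_T(t · u(x,y) · k)‖ ≤ 1_{C_X}(x) · (if H(t) < H₀ then 0 else A + B · H(t)^{1−1/[E:ℚ]})`.
[cite: Rogawski1990, §7.2 Prop. 7.2.1 (p. 95)] [cite: Arthur1978TraceFormulaI, §8] -/
theorem exists_majorant_norm_singularBracket_torus_heisElt_mul (hc : c * c = 1) (hc1 : c ≠ 1)
    {a b : Eˣ} (hab : (a : E) ≠ (b : E)) {g₀ : (quasiSplit F E c 3).Rational} {γ₀ : (quasiSplit F E c 3).arithmeticSubgroup}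
    (hg₀ : ((g₀.val : GL (Fin 3) E) : Matrix (Fin 3) (Fin 3) E) = !![(a : E), 0, 0; 0, b, 0; 0, 0, a])
    (hγ₀ : (γ₀ : (quasiSplit F E c 3).Adelic) = (quasiSplit F E c 3).toAdelic g₀)
    {f : (quasiSplit F E c 3).Adelic → ℂ} (hf : IsQuasiSplitTest F E c 3 f)
    {S_T : Set (borelAdelic F E c 3)} (hSTt : ∀ t ∈ S_T, torusPart t = t)
    {R₂ : Set (AdeleRing (𝓞 E) E)} (hR₂ : IsCompact R₂)
    (hroot : ∀ t ∈ S_T, 1 ≤ borelHeight (t : (quasiSplit F E c 3).Adelic) →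
      (((diagUnit t.2 0)⁻¹ * diagUnit t.2 2 : (AdeleRing (𝓞 E) E)ˣ) : AdeleRing (𝓞 E) E) ∈ R₂)
    {κ : ℝ}
    (hbal : ∀ t ∈ S_T, ∀ w : InfinitePlace E,
      ‖((((diagUnit t.2 0)⁻¹ * diagUnit t.2 1 : (AdeleRing (𝓞 E) E)ˣ) : AdeleRing (𝓞 E) E)).1 w‖ ≤
        κ * ((borelHeight (t : (quasiSplit F E c 3).Adelic) : ℝ) ^ (-(1 / (Module.finrank ℚ E : ℝ)))))
    (hH : ∀ t : torusInBorel F E c 3, borelHeight ((t : borelAdelic F E c 3) : (quasiSplit F E c 3).Adelic) =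
      IdeleClassGroup.ideleNorm E (diagUnit (t : borelAdelic F E c 3).2 0) * borelHeight (1 : (quasiSplit F E c 3).Adelic))
    (hwin : ∀ H₀ R : ℝ≥0, 0 < H₀ → ∃ L₁ : Set (AdeleRing (𝓞 E) E), IsCompact L₁ ∧ ∀ t : torusInBorel F E c 3,
      (t : borelAdelic F E c 3) ∈ S_T →
      H₀ ≤ borelHeight ((t : borelAdelic F E c 3) : (quasiSplit F E c 3).Adelic) →
      borelHeight ((t : borelAdelic F E c 3) : (quasiSplit F E c 3).Adelic) ≤ R →
        ((((diagUnit (t : borelAdelic F E c 3).2 0)⁻¹ * diagUnit (t : borelAdelic F E c 3).2 2)⁻¹ : (AdeleRing (𝓞 E) E)ˣ) :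
          AdeleRing (𝓞 E) E) ∈ L₁)
    (hmod : ∀ t : torusInBorel F E c 3,
      traceZeroModulus ((diagUnit (t : borelAdelic F E c 3).2 0)⁻¹ * diagUnit (t : borelAdelic F E c 3).2 2)
        (conjAdele_torusCentralScalar t (glDiagonal_diagUnit_torus t)) =
        (IdeleClassGroup.ideleNorm E (diagUnit (t : borelAdelic F E c 3).2 0))⁻¹)
    (hnorm : ∀ t : torusInBorel F E c 3,
      IdeleClassGroup.ideleNorm E ((diagUnit (t : borelAdelic F E c 3).2 0)⁻¹ * diagUnit (t : borelAdelic F E c 3).2 2) =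
        ((IdeleClassGroup.ideleNorm E (diagUnit (t : borelAdelic F E c 3).2 0))⁻¹) ^ 2)
    (μY : Measure (traceZeroAdele F E c)) [μY.IsAddHaarMeasure] [μY.Regular] {T : ℝ≥0} (hT : 0 < T) :
    ∃ (C_X : Set (AdeleRing (𝓞 E) E)) (H₀ : ℝ≥0) (A B : ℝ), IsCompact C_X ∧ 0 < H₀ ∧ 0 ≤ A ∧ 0 ≤ B ∧
      ∀ t : torusInBorel F E c 3, (t : borelAdelic F E c 3) ∈ S_T →
      ∀ k : (quasiSplit F E c 3).Adelic, adelicVal F E c 3 _ k ∈ standardMaximalCompactGL 3 E →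
      ∀ (x : AdeleRing (𝓞 E) E) (y : traceZeroAdele F E c),
        ‖(∑' n : {n : ↥((adelicUnipotent F E c 3).subgroupOf (quasiSplit F E c 3).arithmeticSubgroup ⊓
              Subgroup.centralizer ({γ₀} : Set (quasiSplit F E c 3).arithmeticSubgroup)) // n ≠ 1},
            f ((((t : borelAdelic F E c 3) : (quasiSplit F E c 3).Adelic) *
                  (((heisElt hc x y : unipotentInBorel F E c 3) : borelAdelic F E c 3) : (quasiSplit F E c 3).Adelic) * k)⁻¹ *
                (((n.1 : (quasiSplit F E c 3).arithmeticSubgroup) * γ₀ : (quasiSplit F E c 3).arithmeticSubgroup) :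
                  (quasiSplit F E c 3).Adelic) *
                (((t : borelAdelic F E c 3) : (quasiSplit F E c 3).Adelic) *
                  (((heisElt hc x y : unipotentInBorel F E c 3) : borelAdelic F E c 3) : (quasiSplit F E c 3).Adelic) * k))) -
          Set.indicator {y : (quasiSplit F E c 3).Adelic | T < borelHeight y}
            (fun y => (μY (traceZeroFundamentalDomain F E c)).toReal⁻¹ • ∫ w : traceZeroAdele F E c,
              f (y⁻¹ * ((γ₀ : (quasiSplit F E c 3).Adelic) *
                (((heisElt hc 0 w : unipotentInBorel F E c 3) : borelAdelic F E c 3) : (quasiSplit F E c 3).Adelic)) * y) ∂μY)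
            (((t : borelAdelic F E c 3) : (quasiSplit F E c 3).Adelic) *
              (((heisElt hc x y : unipotentInBorel F E c 3) : borelAdelic F E c 3) : (quasiSplit F E c 3).Adelic) * k)‖ ≤
        C_X.indicator (fun _ => (1 : ℝ)) x *
          (if borelHeight (((t : borelAdelic F E c 3)) : (quasiSplit F E c 3).Adelic) < H₀ then 0
           else A + B * ((borelHeight (((t : borelAdelic F E c 3)) : (quasiSplit F E c 3).Adelic) : ℝ) ^
             (1 - 1 / (Module.finrank ℚ E : ℝ)))) := by
  classical
  haveI := locallyCompactSpace_traceZeroAdele (F := F) (E := E) (c := c)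
  -- §0 the data of the family: sup bound, support compacta, oscillation
  obtain ⟨M, hM0, hM⟩ := exists_forall_norm_le_of_isQuasiSplitTest hf
  obtain ⟨C_X, C_Y, hCXc, hCYc, hsupp⟩ := exists_isCompact_support_singularCentreFamily hc hab hg₀ hγ₀ hf.hasCompactSupport'
  obtain ⟨Pc, hPcc, hPsub⟩ := exists_isCompact_traceZeroFundamentalDomain_subset (F := F) (E := E) (c := c) hc
  have hVc : IsCompact (closure (traceZeroFundamentalDomain F E c)) := hPcc.closure_of_subset hPsub
  obtain ⟨m, hm0, Cosc, hCosc0, hosc⟩ := exists_forall_norm_singularCentreFamily_sub_le_rpow hc hf hSTt hR₂ hroot hbal hVc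
  have hmE : (m : E) ≠ 0 := Nat.cast_ne_zero.2 hm0
  set r : (AdeleRing (𝓞 E) E)ˣ := Units.map (algebraMap E (AdeleRing (𝓞 E) E) : E →* AdeleRing (𝓞 E) E) (Units.mk0 (m : E) hmE)
    with hrdef
  have hr : conjAdele F E c (r : AdeleRing (𝓞 E) E) = r := conjAdele_natCast_units (F := F) (c := c) hmE
  have hrp : r ∈ GaloisRepresentations.principalIdeles E := ⟨_, rfl⟩
  -- §0 the three lattice-sum regimes
  set L₀ : Set (AdeleRing (𝓞 E) E) := (fun z => z * (r : AdeleRing (𝓞 E) E)) '' R₂ with hL₀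
  have hL₀c : IsCompact L₀ := hR₂.image (continuous_id.mul continuous_const)
  have hS₀ : IsCompact ({0} : Set (traceZeroAdele F E c)) := isCompact_singleton
  obtain ⟨D, hD0, hcusp⟩ := exists_const_norm_tsum_centreLine_sub_smul_integral_le (F := F) (E := E) (c := c) μY hc hc1 hCYc hS₀ hL₀c
  obtain ⟨c₀, hc₀0, hlow⟩ := exists_forall_tsum_centreLine_eq_zero' (F := F) (E := E) (c := c) hCYc hS₀
  -- heights: `H₁ = H(1)`, the cut-offs `H₀` and `R`
  set H₁ : ℝ≥0 := borelHeight (1 : (quasiSplit F E c 3).Adelic) with hH₁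
  have hH₁0 : 0 < H₁ := borelHeight_pos _
  set c₁ : ℝ≥0 := ⟨c₀ + 1, by linarith⟩ with hc₁
  have hc₁0 : 0 < c₁ := NNReal.coe_pos.1 (by change (0 : ℝ) < c₀ + 1; linarith)
  set H₀ : ℝ≥0 := min T (H₁ / c₁) with hH₀def
  have hH₀0 : 0 < H₀ := lt_min hT (div_pos hH₁0 hc₁0)
  set R : ℝ≥0 := max T 1 with hRdef
  obtain ⟨L₁, hL₁c, hL₁⟩ := hwin H₀ R hH₀0
  obtain ⟨N₀, hmid⟩ := exists_nat_norm_tsum_centreLine_le (F := F) (E := E) (c := c) hCYc hS₀ hL₁c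
  -- the constants
  set κY : ℝ := (μY (traceZeroFundamentalDomain F E c)).toReal⁻¹ with hκY
  have hκY0 : 0 ≤ κY := inv_nonneg.2 ENNReal.toReal_nonneg
  set A : ℝ := max ((N₀ : ℝ) * M + κY * ((R : ℝ) / H₁) * (M * μY.real C_Y)) M with hAdef
  have hA0 : 0 ≤ A := le_max_of_le_right hM0
  set B : ℝ := Cosc * D / (H₁ : ℝ) with hBdef
  have hB0 : 0 ≤ B := div_nonneg (mul_nonneg hCosc0 hD0) (NNReal.coe_nonneg _)
  refine ⟨C_X, H₀, A, B, hCXc, hH₀0, hA0, hB0, fun t ht k hk x y => ?_⟩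
  -- letters for this `t`
  set d := diagUnit (t : borelAdelic F E c 3).2 with hddef
  have hd : glDiagonal 3 (AdeleRing (𝓞 E) E) d = adelicVal F E c 3 _ ((t : borelAdelic F E c 3) : (quasiSplit F E c 3).Adelic) :=
    glDiagonal_diagUnit_torus t
  set l : (AdeleRing (𝓞 E) E)ˣ := (d 0)⁻¹ * d 2 with hldef
  have hl : conjAdele F E c (l : AdeleRing (𝓞 E) E) = l := conjAdele_torusCentralScalar t hd
  set n₀ : ℝ≥0 := IdeleClassGroup.ideleNorm E (d 0) with hn₀
  set H : ℝ≥0 := borelHeight (((t : borelAdelic F E c 3)) : (quasiSplit F E c 3).Adelic) with hHdef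
  have hHt : H = n₀ * H₁ := hH t
  have hn₀H : (n₀ : ℝ) = H / H₁ := by
    rw [hHt, NNReal.coe_mul, mul_div_assoc, div_self (ne_of_gt (NNReal.coe_pos.2 hH₁0)), mul_one]
  have hmodt : traceZeroModulus l hl = n₀⁻¹ := hmod t
  have hkKU : k ∈ ((standardMaximalCompactGL 3 E).comap (adelicVal F E c 3 ((StdForm.antidiagonal 3).over E)) :
      Subgroup (quasiSplit F E c 3).Adelic) := Subgroup.mem_comap.2 hk
  have hHk : borelHeight k = H₁ := by
    have h := borelHeight_mul_of_mem_comap_standardMaximalCompactGL (N := 3) hkKU 1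
    rwa [one_mul] at h
  -- the centre family at `(k, x)`
  set Fk : traceZeroAdele F E c → ℂ := fun y' =>
    f (k⁻¹ * ((((heisElt hc x (0 : traceZeroAdele F E c) : unipotentInBorel F E c 3) : borelAdelic F E c 3) :
          (quasiSplit F E c 3).Adelic)⁻¹ *
        ((γ₀ : (quasiSplit F E c 3).Adelic) *
          (((heisElt hc 0 y' : unipotentInBorel F E c 3) : borelAdelic F E c 3) : (quasiSplit F E c 3).Adelic)) *
        (((heisElt hc x (0 : traceZeroAdele F E c) : unipotentInBorel F E c 3) : borelAdelic F E c 3) :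
          (quasiSplit F E c 3).Adelic)) * k) with hFk
  have hFkm : Measurable Fk := by
    have h1 : Continuous fun y' : traceZeroAdele F E c =>
        (((heisElt hc 0 y' : unipotentInBorel F E c 3) : borelAdelic F E c 3) : (quasiSplit F E c 3).Adelic) :=
      continuous_subtype_val.comp (continuous_subtype_val.comp ((continuous_heisElt hc).comp
        (continuous_const.prodMk continuous_id)))
    exact (hf.continuous'.comp ((((continuous_const.mul (continuous_const.mul h1)).mul continuous_const).const_mul _ |>.mul
      continuous_const))).measurable
  have hFkC : ∀ y' ∉ C_Y, Fk y' = 0 := fun y' hy' => by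
    by_contra h
    exact hy' (hsupp k hk x y' h).2
  have hFkM : ∀ y', ‖Fk y'‖ ≤ M := fun y' => hM _
  -- rewrite the bracket along `t · u(x,y) · k`
  rw [tsum_singular_torus_heisElt_mul hc hab hg₀ hγ₀ t hd x y k f]
  have hind : Set.indicator {y : (quasiSplit F E c 3).Adelic | T < borelHeight y}
      (fun y => (μY (traceZeroFundamentalDomain F E c)).toReal⁻¹ • ∫ w : traceZeroAdele F E c,
        f (y⁻¹ * ((γ₀ : (quasiSplit F E c 3).Adelic) *
          (((heisElt hc 0 w : unipotentInBorel F E c 3) : borelAdelic F E c 3) : (quasiSplit F E c 3).Adelic)) * y) ∂μY)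
      (((t : borelAdelic F E c 3) : (quasiSplit F E c 3).Adelic) *
        (((heisElt hc x y : unipotentInBorel F E c 3) : borelAdelic F E c 3) : (quasiSplit F E c 3).Adelic) * k) =
      if T < H then κY • ((((traceZeroModulus l hl : ℝ≥0) : ℝ))⁻¹ • ∫ w : traceZeroAdele F E c, Fk w ∂μY) else 0 := by
    have hHy : borelHeight (((t : borelAdelic F E c 3) : (quasiSplit F E c 3).Adelic) *
        (((heisElt hc x y : unipotentInBorel F E c 3) : borelAdelic F E c 3) : (quasiSplit F E c 3).Adelic) * k) = H := by
      rw [borelHeight_torus_heisElt_mul hc t hd x y k, hHk, ← hHt]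
    by_cases hT' : T < H
    · have hmem : (((t : borelAdelic F E c 3) : (quasiSplit F E c 3).Adelic) *
          (((heisElt hc x y : unipotentInBorel F E c 3) : borelAdelic F E c 3) : (quasiSplit F E c 3).Adelic) * k) ∈
          {y : (quasiSplit F E c 3).Adelic | T < borelHeight y} := by
        rw [Set.mem_setOf_eq, hHy]; exact hT'
      rw [Set.indicator_of_mem hmem, if_pos hT', integral_center_singular_torus_heisElt_mul hc hg₀ hγ₀ t hd x y k μY f,
        NNReal.coe_inv]
    · have hnmem : (((t : borelAdelic F E c 3) : (quasiSplit F E c 3).Adelic) *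
          (((heisElt hc x y : unipotentInBorel F E c 3) : borelAdelic F E c 3) : (quasiSplit F E c 3).Adelic) * k) ∉
          {y : (quasiSplit F E c 3).Adelic | T < borelHeight y} := by
        rw [Set.mem_setOf_eq, hHy]; exact hT'
      rw [Set.indicator_of_notMem hnmem, if_neg hT']
  rw [hind]
  -- case `x ∉ C_X`: the family vanishes identically
  by_cases hx : x ∈ C_X
  swap
  · have hF0 : ∀ y', Fk y' = 0 := fun y' => by
      by_contra h
      exact hx (hsupp k hk x y' h).1
    rw [Set.indicator_of_notMem hx, zero_mul]
    refine le_of_eq (norm_eq_zero.2 ?_)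
    have h1 : (fun w : {w : rationalTraceZero F E c // w ≠ 0} => Fk (smulTraceZero l hl ((w.1 : rationalTraceZero F E c) :
        traceZeroAdele F E c))) = fun _ => 0 := funext fun w => hF0 _
    have h2 : (fun w : traceZeroAdele F E c => Fk w) = fun _ => 0 := funext fun w => hF0 _
    change (∑' w : {w : rationalTraceZero F E c // w ≠ 0}, Fk (smulTraceZero l hl _)) -
      (if T < H then κY • ((((traceZeroModulus l hl : ℝ≥0) : ℝ))⁻¹ • ∫ w, Fk w ∂μY) else 0) = 0
    rw [h1, tsum_zero]
    split_ifs
    · rw [show (∫ w, Fk w ∂μY) = 0 by rw [show Fk = fun _ => 0 from h2, integral_zero], smul_zero, smul_zero, sub_zero]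
    · rw [sub_zero]
  rw [Set.indicator_of_mem hx, one_mul]
  change ‖(∑' w : {w : rationalTraceZero F E c // w ≠ 0}, Fk (smulTraceZero l hl ((w.1 : rationalTraceZero F E c) :
      traceZeroAdele F E c))) - (if T < H then κY • ((((traceZeroModulus l hl : ℝ≥0) : ℝ))⁻¹ • ∫ w, Fk w ∂μY) else 0)‖ ≤ _
  have hHpos : (0 : ℝ) < H := NNReal.coe_pos.2 (borelHeight_pos _)
  by_cases hlowH : H < H₀
  · -- LOW: the T-piece is off and the lattice escapes
    rw [if_pos hlowH]
    have hTH : ¬ T < H := not_lt.2 ((le_of_lt hlowH).trans (min_le_left _ _))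
    rw [if_neg hTH, sub_zero]
    refine le_of_eq (norm_eq_zero.2 ?_)
    have hnl : c₀ < (IdeleClassGroup.ideleNorm E l : ℝ) := by
      rw [hldef, hnorm t]
      -- `n₀ = H / H₁ < H₀ / H₁ ≤ 1 / c₁`, so `n₀⁻¹ > c₁ = c₀ + 1` and `(n₀⁻¹)² ≥ n₀⁻¹ > c₀` (as `n₀⁻¹ ≥ 1`)
      have hn₀pos : 0 < n₀ := by
        have : (0 : ℝ) < n₀ := by rw [hn₀H]; exact div_pos hHpos (NNReal.coe_pos.2 hH₁0)
        exact_mod_cast this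
      have hn₀lt : n₀ < c₁⁻¹ := by
        have h1 : n₀ * H₁ < H₀ := by rw [← hHt]; exact hlowH
        have h2 : H₀ ≤ H₁ / c₁ := min_le_right _ _
        have h3 : n₀ * H₁ < H₁ / c₁ := lt_of_lt_of_le h1 h2
        rw [div_eq_mul_inv, mul_comm H₁] at h3
        exact lt_of_mul_lt_mul_right' h3
      have hinv : c₁ < n₀⁻¹ := (lt_inv_comm₀ hc₁0 hn₀pos).2 hn₀lt
      have hone : 1 ≤ n₀⁻¹ := by
        have h : (1 : ℝ≥0) ≤ c₁ := NNReal.coe_le_coe.1 (by change (1 : ℝ) ≤ c₀ + 1; linarith)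
        exact h.trans hinv.le
      have hsq : n₀⁻¹ ≤ (n₀⁻¹) ^ 2 := by
        rw [sq]; exact le_mul_of_one_le_right zero_le hone
      have hfin : (c₀ : ℝ) < ((n₀⁻¹ : ℝ≥0) : ℝ) := by
        have h : ((c₁ : ℝ≥0) : ℝ) = c₀ + 1 := by rw [hc₁]; rfl
        have h' : (c₁ : ℝ) < ((n₀⁻¹ : ℝ≥0) : ℝ) := NNReal.coe_lt_coe.2 hinv
        linarith
      exact hfin.trans_le (NNReal.coe_le_coe.2 hsq)
    have h0 := hlow l hl hnl 0 (mem_singleton 0) Fk hFkC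
    simp only [add_zero] at h0
    exact h0
  · rw [if_neg hlowH]
    have hH₀le : H₀ ≤ H := not_lt.1 hlowH
    have hrpow0 : 0 ≤ B * (H : ℝ) ^ (1 - 1 / (Module.finrank ℚ E : ℝ)) := mul_nonneg hB0 (Real.rpow_nonneg hHpos.le _)
    -- the norm of the `T`-piece
    have hint : ‖∫ w, Fk w ∂μY‖ ≤ M * μY.real C_Y := by
      rw [← setIntegral_eq_integral_of_forall_compl_eq_zero (s := C_Y) (fun w hw => hFkC w hw)]
      exact norm_setIntegral_le_of_norm_le_const hCYc.measure_lt_top fun w _ => hFkM w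
    have hmodR : (((traceZeroModulus l hl : ℝ≥0) : ℝ))⁻¹ = H / H₁ := by rw [hmodt, NNReal.coe_inv, inv_inv, hn₀H]
    by_cases hcuspH : R < H
    · -- CUSP
      have h1H : 1 ≤ H := (le_max_right T 1).trans hcuspH.le
      have hTH : T < H := lt_of_le_of_lt (le_max_left T 1) hcuspH
      rw [if_pos hTH, smul_smul]
      have hlL₀ : (l : AdeleRing (𝓞 E) E) * (r : AdeleRing (𝓞 E) E) ∈ L₀ := ⟨_, hroot _ ht h1H, rfl⟩
      have hω : ∀ y', ∀ v ∈ traceZeroFundamentalDomain F E c,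
          ‖Fk y' - Fk (y' + smulTraceZero l hl (smulTraceZero r hr v))‖ ≤
            Cosc * ((H : ℝ) ^ (-(1 / (Module.finrank ℚ E : ℝ)))) := by
        intro y' v hv
        have h := hosc t ht h1H k hk (γ₀ : (quasiSplit F E c 3).Adelic) x y' v (subset_closure hv)
        rw [nsmul_eq_smulTraceZero (F := F) (c := c) hmE v] at h
        exact h
      have key := hcusp Fk hFkm hFkC M hFkM l hl r hr hrp hlL₀ 0 (mem_singleton 0) _
        (mul_nonneg hCosc0 (Real.rpow_nonneg hHpos.le _)) hω
      simp only [add_zero] at key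
      refine key.trans ?_
      rw [hmodR]
      have hpow : Cosc * (H : ℝ) ^ (-(1 / (Module.finrank ℚ E : ℝ))) * ((H : ℝ) / H₁) * D =
          B * (H : ℝ) ^ (1 - 1 / (Module.finrank ℚ E : ℝ)) := by
        rw [hBdef, sub_eq_add_neg, Real.rpow_add hHpos, Real.rpow_one]
        field_simp
      rw [hpow]
      exact add_le_add_left (le_max_right _ _) _
    · -- MIDDLE
      have hHR : H ≤ R := not_lt.1 hcuspH
      have hlL₁ : ((l⁻¹ : (AdeleRing (𝓞 E) E)ˣ) : AdeleRing (𝓞 E) E) ∈ L₁ := hL₁ t ht hH₀le hHR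
      have hsum := hmid Fk hFkC M hM0 hFkM l hl hlL₁ 0 (mem_singleton 0)
      simp only [add_zero] at hsum
      have hTpiece : ‖(if T < H then κY • ((((traceZeroModulus l hl : ℝ≥0) : ℝ))⁻¹ • ∫ w, Fk w ∂μY) else 0)‖ ≤
          κY * ((R : ℝ) / H₁) * (M * μY.real C_Y) := by
        split_ifs
        · rw [norm_smul, norm_smul, Real.norm_of_nonneg hκY0, hmodR,
            Real.norm_of_nonneg (div_nonneg (NNReal.coe_nonneg _) (NNReal.coe_nonneg _)), mul_assoc]
          refine mul_le_mul_of_nonneg_left ?_ hκY0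
          exact mul_le_mul (div_le_div_of_nonneg_right (NNReal.coe_le_coe.2 hHR) (NNReal.coe_nonneg _)) hint
            (norm_nonneg _) (div_nonneg (NNReal.coe_nonneg _) (NNReal.coe_nonneg _))
        · rw [norm_zero]
          exact mul_nonneg (mul_nonneg hκY0 (div_nonneg (NNReal.coe_nonneg _) (NNReal.coe_nonneg _)))
            (mul_nonneg hM0 measureReal_nonneg)
      calc _ ≤ ‖∑' w : {w : rationalTraceZero F E c // w ≠ 0}, Fk (smulTraceZero l hl ((w.1 : rationalTraceZero F E c) :
              traceZeroAdele F E c))‖ +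
            ‖(if T < H then κY • ((((traceZeroModulus l hl : ℝ≥0) : ℝ))⁻¹ • ∫ w, Fk w ∂μY) else 0)‖ := norm_sub_le _ _
        _ ≤ (N₀ : ℝ) * M + κY * ((R : ℝ) / H₁) * (M * μY.real C_Y) := add_le_add hsum hTpiece
        _ ≤ A := le_max_left _ _
        _ ≤ A + B * (H : ℝ) ^ (1 - 1 / (Module.finrank ℚ E : ℝ)) := le_add_of_nonneg_right hrpow0

end Majorant

end UnitaryGroup

end Literature.NumberTheory.Automorphic

end
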